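import Mathlib

/-!
# B16 (1.71)/(1.102) vs [III] (2.21): a quadratic form built from component-supported pieces has no cross-component terms

Reproduction (statement-level, abstract, finite model) of the bookkeeping behind Balaban, *Large field renormalization. II*,
Comm. Math. Phys. 122 (1989) 355–392, p. 378 ll. 39–41 («We use the fact that these integrations factorize in components of
Z. We denote the component by X … and we define» (1.71) with the exponent `−½⟨DH″_{1,k,X}B, ζDH″_{1,k,X}B⟩`), p. 390 (1.102)
(«the operation 𝐓_k for a component Y of the set ⋃Y_i has the form 𝐓_k(Y) = χ^c_k(Y^{~−6})χ_{k,Λ}δ_G(V_kV_Λ^{−1})𝐓′_k(Y)») and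
p. 391 ll. 1–2 («with all the expressions satisfying the induction hypothesis described in Sect. 2 [III]»), against the clause
of [III] = Balaban, Comm. Math. Phys. 119 (1988) 243–285, p. 258 after (2.21): «the quadratic form in the exponential couples
only the fields A_j in the same component of Z_{j+1}∩Ω_{j+1}.  The other terms of this quadratic form are included into the
effective action into 𝐁-terms».  The per-component construction rests on [IV] = Balaban, Comm. Math. Phys. 122 (1989) 175–202,
p. 192 (1.74) ¶: «U_{k,Z} = U_{k,Z}(V_k) = U(𝔹_k(Z), M·(Q_k^*V_k)) … It is defined in each component of Z separately.»
Cell GAPS C-adv3-38.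

Finite model: sites/plaquettes `P`, components `ι`, a component map `comp : P → ι`; the pieces `f i : P → ℝ` stand for
`p ↦ (DH″_{1,k,X_i}B)(p)` and are SUPPORTED in their own component (`SupportedIn comp f`); the weight `w` stands for `η^d ζ`.
Proved: the weighted square of the sum of the pieces equals the sum of the weighted squares of the pieces
(`blockForm_eq_sum_of_supportedIn`): there are NO cross-component terms, so the clause of [III] (2.21) is met with an empty
𝐁-remainder PROVIDED the pieces are component-supported — which is what «defined in each component of Z separately» ([IV]
(1.74)) supplies for the background field and hence for the operators built from it.  Nothing about the variational problem,
the operators `H″`, `D`, or lattices is asserted; the premise `SupportedIn` is the reading of [IV] (1.74) ¶ and is NOT proved here.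
[cite: Balaban1989LargeFieldII, p.378, (1.71), p.390 (1.102), p.391; Balaban1988Convergent, p.258 (2.21); Balaban1989LargeFieldI, p.192 (1.74)]
-/

namespace Literature.MathematicalPhysics.QuantumFieldTheory.Balaban1983to89.B16ComponentForm

variable {ι P : Type*}

/-- The weighted quadratic form `Σ_p w p · (Σ_i f i p)²` of the SUM of the pieces — the shape of B16 (1.21)
`Σ_{p∈T_η} η^d ζ(x(p)) |(DH″_{1,k,Z}B)(p)|²` when `DH″_{1,k,Z}B = Σ_i DH″_{1,k,X_i}B`.
[cite: Balaban1989LargeFieldII, (1.21) p.361, (1.70) p.377] -/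
def blockForm [Fintype ι] [Fintype P] (w : P → ℝ) (f : ι → P → ℝ) : ℝ := ∑ p, w p * (∑ i, f i p) ^ 2

/-- The piece `f i` is supported in the component `i` of the partition `comp`. [cite: Balaban1989LargeFieldI, (1.74) p.192] -/
def SupportedIn (comp : P → ι) (f : ι → P → ℝ) : Prop := ∀ i p, f i p ≠ 0 → comp p = i

/-- Pairwise disjoint supports. [folklore] -/
def DisjointSupports (f : ι → P → ℝ) : Prop := ∀ i j, i ≠ j → ∀ p, f i p = 0 ∨ f j p = 0

/-- Component-supported pieces have pairwise disjoint supports. [folklore] -/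
theorem SupportedIn.disjointSupports {comp : P → ι} {f : ι → P → ℝ} (h : SupportedIn comp f) : DisjointSupports f := by
  intro i j hij p
  by_contra hc
  have hc' : f i p ≠ 0 ∧ f j p ≠ 0 := by
    constructor <;> intro h0 <;> exact hc (by first | exact Or.inl h0 | exact Or.inr h0)
  exact hij ((h i p hc'.1).symm.trans (h j p hc'.2))

/-- A single cross term vanishes: `Σ_p w p · f i p · f j p = 0` for `i ≠ j`. [folklore] -/
theorem cross_term_eq_zero [Fintype P] {w : P → ℝ} {f : ι → P → ℝ} (h : DisjointSupports f) {i j : ι} (hij : i ≠ j) :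
    ∑ p, w p * (f i p * f j p) = 0 := by
  apply Finset.sum_eq_zero
  intro p _
  rcases h i j hij p with h0 | h0 <;> simp [h0]

/-- The form of the sum of component-supported pieces is the sum of the per-component forms: no cross-component
coupling, i.e. the «𝐁-remainder» of [III] (2.21) is zero for such a form.
[cite: Balaban1988Convergent, p.258 (2.21); Balaban1989LargeFieldII, (1.71) p.379] -/
theorem blockForm_eq_sum_of_disjointSupports [Fintype ι] [Fintype P] (w : P → ℝ) {f : ι → P → ℝ} (h : DisjointSupports f) :
    blockForm w f = ∑ i, ∑ p, w p * (f i p) ^ 2 := by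
  unfold blockForm
  have key : ∀ p, w p * (∑ i, f i p) ^ 2 = ∑ i, w p * (f i p) ^ 2 := by
    intro p
    rw [sq, Finset.sum_mul_sum, Finset.mul_sum]
    apply Finset.sum_congr rfl
    intro i _
    rw [Finset.mul_sum]
    rw [Finset.sum_eq_single i]
    · ring
    · intro j _ hji
      rcases h i j (Ne.symm hji) p with h0 | h0 <;> simp [h0]
    · intro hi; exact absurd (Finset.mem_univ i) hi
  rw [Finset.sum_congr rfl (fun p _ => key p)]
  exact Finset.sum_comm

/-- The (2.21) clause for component-supported pieces: the form of the sum is the sum of the per-component forms.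
[cite: Balaban1988Convergent, p.258 (2.21); Balaban1989LargeFieldI, p.192 (1.74)] -/
theorem blockForm_eq_sum_of_supportedIn [Fintype ι] [Fintype P] (w : P → ℝ) {comp : P → ι} {f : ι → P → ℝ} (h : SupportedIn comp f) :
    blockForm w f = ∑ i, ∑ p, w p * (f i p) ^ 2 :=
  blockForm_eq_sum_of_disjointSupports w h.disjointSupports

/-- Each per-component form is a sum over the sites of that component only. [folklore] -/
theorem component_form_eq_filter [Fintype P] [DecidableEq ι] (w : P → ℝ) {comp : P → ι} {f : ι → P → ℝ} (h : SupportedIn comp f) (i : ι) :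
    ∑ p, w p * (f i p) ^ 2 = ∑ p ∈ Finset.univ.filter (fun p => comp p = i), w p * (f i p) ^ 2 := by
  rw [Finset.sum_filter]
  apply Finset.sum_congr rfl
  intro p _
  by_cases hp : comp p = i
  · simp [hp]
  · have : f i p = 0 := by
      by_contra hc; exact hp (h i p hc)
    simp [hp, this]

end Literature.MathematicalPhysics.QuantumFieldTheory.Balaban1983to89.B16ComponentForm
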